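import Literature.AlgebraicGeometry.Frobenioids.ElementaryIsomorphisms
import Literature.AlgebraicGeometry.Frobenioids.ModelFrobenioidFunctor
import HarnessLib

/-!
# Frobenioids I, Def. 1.1 (iii) / Thm. 5.2 (i): transport of `(deg_Fr, Base, Div)` along an isomorphism of
# functors into an elementary (or model) Frobenioid

Mochizuki, *The geometry of Frobenioids I: the general theory*, Kyushu J. Math. **62** (2008)
293–400, §1, Definition 1.1 (iii) p. 19 (the elementary Frobenioid `F_Φ`: a morphism is a triple
`(Base, Div, deg_Fr)` with the displayed composition law) and §5 Thm. 5.2 (i) p. 100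
[cite: MochizukiFrdI2008, Def. 1.1 (iii) p.19].

PROOF-ONLY toolkit (seat abc-iut-L1-t10 gen 3; cell abc-iut, L1 sub-DAG W3 row C54/L06): for two functors
`K₁, K₂ : J ⥤ F_Φ` and an isomorphism `ω : K₁ ≅ K₂`, every arrow `f` of `J` has
`deg_Fr(K₁ f) = deg_Fr(K₂ f)` (`degFr_map_eq_of_natIso`), `Base(K₁ f) ≫ Base(ω_Y) = Base(ω_X) ≫ Base(K₂ f)`
(`base_map_natIso`) and — when the monoids `Φ(A)` have no units but `1` (e.g. divisorial / perf-factorial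
`Φ`) — `Div(K₁ f) = Base(ω_X)^* Div(K₂ f)` (`div_map_eq_of_natIso`): isomorphisms of `F_Φ` have Frobenius
degree `1` and unit, hence trivial, zero divisor (`ElementaryIsomorphisms.lean`), and the composition law of
Def. 1.1 (iii) does the rest.  The same for functors into a model Frobenioid, read through its structure
functor `toElem` (`ModelFrobenioid.degFr_map_eq_of_natIso`, `…div_map_eq_of_natIso`,
`…baseMap_map_natIso`).  This is the bookkeeping by which "compatible with the functors to the respective
elementary Frobenioids" (Prop. 5.3, Prop. 5.5 (iv), Cor. 5.4) is moved along 1-commutative squares.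
No statement of the paper is restated; nothing here bears on [IUTchIII].
-/

namespace Literature.AlgebraicGeometry.Frobenioids

open CategoryTheory Opposite

universe w v v' u u'

namespace ElemFrobenioid

variable {D : Type u} [Category.{v} D] {Φ : Dᵒᵖ ⥤ CommMonCat.{w}} {J : Type u'} [Category.{v'} J]
  {K₁ K₂ : J ⥤ ElemFrobenioid Φ}

/-- Frobenius degrees agree along an isomorphism of functors into `F_Φ`.
[cite: MochizukiFrdI2008, Def. 1.1 (iii) p.19] -/
theorem degFr_map_eq_of_natIso (ω : K₁ ≅ K₂) {X Y : J} (f : X ⟶ Y) :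
    degFr (K₁.map f) = degFr (K₂.map f) := by
  have h := congrArg degFr (ω.hom.naturality f)
  rw [degFr_comp, degFr_comp, degFr_eq_one_of_isIso (ω.hom.app Y), degFr_eq_one_of_isIso (ω.hom.app X),
    mul_one, one_mul] at h
  exact h

/-- Base maps form a commutative square along an isomorphism of functors into `F_Φ`.
[cite: MochizukiFrdI2008, Def. 1.1 (iii) p.19] -/
theorem base_map_natIso (ω : K₁ ≅ K₂) {X Y : J} (f : X ⟶ Y) :
    Base (K₁.map f) ≫ Base (ω.hom.app Y) = Base (ω.hom.app X) ≫ Base (K₂.map f) := by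
  have h := congrArg Base (ω.hom.naturality f)
  rwa [base_comp, base_comp] at h

/-- **Zero divisors are transported along an isomorphism of functors into `F_Φ`** by pull-back along the
base of its components, when the `Φ(A)` have trivial units: `Div(K₁ f) = Base(ω_X)^* Div(K₂ f)`.
[cite: MochizukiFrdI2008, Def. 1.1 (iii) p.19] -/
theorem div_map_eq_of_natIso (hΦ : ∀ (A : D) (x : Φ.obj (op A)), IsUnit x → x = 1) (ω : K₁ ≅ K₂)
    {X Y : J} (f : X ⟶ Y) :
    Div (K₁.map f) = pull Φ (Base (ω.hom.app X)) (Div (K₂.map f)) := by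
  have h := congrArg Div (ω.hom.naturality f)
  have hY : Div (ω.hom.app Y) = 1 := hΦ _ _ (isUnit_div_of_isIso (ω.hom.app Y))
  have hX : Div (ω.hom.app X) = 1 := hΦ _ _ (isUnit_div_of_isIso (ω.hom.app X))
  rw [div_comp, div_comp, hY, hX, map_one, one_mul, one_pow, mul_one, degFr_eq_one_of_isIso (ω.hom.app Y),
    PNat.one_coe, pow_one] at h
  exact h

end ElemFrobenioid

namespace ModelFrobenioid

variable {D : Type u} [Category.{v} D] {Φ B : Dᵒᵖ ⥤ CommMonCat.{w}} {DivB : B ⟶ monoidGp Φ}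
  {J : Type u'} [Category.{v'} J] {K₁ K₂ : J ⥤ ModelFrobenioid Φ B DivB}

/-- Frobenius degrees agree along an isomorphism of functors into a model Frobenioid.
[cite: MochizukiFrdI2008, Thm. 5.2 (i) p.100] -/
theorem degFr_map_eq_of_natIso (ω : K₁ ≅ K₂) {X Y : J} (f : X ⟶ Y) :
    degFr (K₁.map f) = degFr (K₂.map f) :=
  ElemFrobenioid.degFr_map_eq_of_natIso (Functor.isoWhiskerRight ω (toElem Φ B DivB)) f

/-- Base maps form a commutative square along an isomorphism of functors into a model Frobenioid.
[cite: MochizukiFrdI2008, Thm. 5.2 (i) p.100] -/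
theorem baseMap_map_natIso (ω : K₁ ≅ K₂) {X Y : J} (f : X ⟶ Y) :
    baseMap (K₁.map f) ≫ baseMap (ω.hom.app Y) = baseMap (ω.hom.app X) ≫ baseMap (K₂.map f) :=
  ElemFrobenioid.base_map_natIso (Functor.isoWhiskerRight ω (toElem Φ B DivB)) f

/-- **Zero divisors are transported along an isomorphism of functors into a model Frobenioid**:
`Div(K₁ f) = Base(ω_X)^* Div(K₂ f)` (trivial units in the `Φ(A)`).
[cite: MochizukiFrdI2008, Thm. 5.2 (i) p.100] -/
theorem div_map_eq_of_natIso (hΦ : ∀ (A : D) (x : Φ.obj (op A)), IsUnit x → x = 1) (ω : K₁ ≅ K₂)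
    {X Y : J} (f : X ⟶ Y) :
    div (K₁.map f) = pull Φ (baseMap (ω.hom.app X)) (div (K₂.map f)) :=
  ElemFrobenioid.div_map_eq_of_natIso hΦ (Functor.isoWhiskerRight ω (toElem Φ B DivB)) f

end ModelFrobenioid

end Literature.AlgebraicGeometry.Frobenioids
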